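import Summits.AtomisticToContinuum.Crystallization.Theorems.FrustratedLawDichotomyStrainedPatchHomConvexSegmentW45

/-!
# RADIAL GROWTH OF THE SHIFTED-FAMILY FORCE and the SLAB CONFINEMENT `T″` (real side of the force-annulus ring certificate [F] of the
# ξ-eliminating U-tree leaf; 27623 `(H) HomFloor (1/625)`, hcp half)

decomp-a2c hand-2 g29 (crux `AperiodicFrustratedLawGap`, stmt-AtomisticToContinuum-27623; BUDGET-F, critic rows 1085 / 1089: architecture of record =
U-tree + ξ-eliminating ring leaf `[T | F | E]`, «T″ LEMMA (hand-2): λ-convexity + centred slope ⇒ ξ confined to (σ₁ + G)/H, def-free corollary style of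
HomXiElimL»).  The energy-exterior certificate [E] is `…HomConvexExterior`; this file is its companion ONE DERIVATIVE DOWN, for the FORCE.

Along the segment `ξ₀ + s(ξ − ξ₀)` the `B`-family points are `p_b + sΔ` (`p_b = latPt U hexFrame b + U(hcpShift + ξ₀)`, `Δ = U(ξ − ξ₀)`), and for a
force profile `W₁` (for the exempt prune's Lennard-Jones kernel: `W₁(r) = r⁻⁷ − r⁻¹³`, so that `W₁(r)·⟪X, Δ⟫/r = (r⁻⁸ − r⁻¹⁴)⟪X, Δ⟫` is the slope kernel
of `…HomExemptMoveBox.exemptNear_of_boxSlope` at `τ = 0`) the component of the `B`-family force along `Δ` is EXACTLY the segment slope sum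
`Σ_b segG W₁ p_b Δ s` of `…TaylorChord` / `…HomConvexSegment`.  Hence `…HomConvexSegment.slope_growth_of_curvature_sum` (force-JACOBIAN floor
`λ‖Δ‖² ≤ Σ_b segGd W₁ p_b Δ s` along the segment) gives:

* §1 (generic label sums) ★ `sum_slope_growth_one` (`Σ segG … 0 + λ‖Δ‖² ≤ Σ segG … 1`), ★ `sum_slope_exterior` (reference force bound `f₀` ⇒
  `(λ‖Δ‖ − f₀)‖Δ‖ ≤ Σ segG … 1`: the radial force GROWS linearly with the distance from the reference shuffle), ★★ `slab_confinement` = T″ (if in addition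
  the target's force component is capped by `σ‖Δ‖` — e.g. the site is NOT exempt — then `λ‖Δ‖ ≤ σ + f₀`);
* §2 (the hcp shifted family, any profile regular on `r ≥ 3/8`) ★★ `hcpForce_growth`, `hcpForce_exterior`, ★★★ `hcpForce_slab_confinement`;
* §3 the Lennard-Jones force profile `r ↦ r⁻⁷ − r⁻¹³` (regularity discharged): ★★★ `hcpForceLJ_exterior` / `hcpForceLJ_slab_confinement`, with the kernel
  algebra `W₁(r)·(x/r) = (r⁻⁸ − r⁻¹⁴)·x`.

How the kernel leaf (hand-1's `entryLeafOKHT`) uses it: certify `λ` (force-Jacobian enclosure of `Σ_b segGd` over the U-box × ξ-ball, the LJ twin of the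
`…HomCurvCentre` kit), `f₀` (interval force at `ξ_ref` over the U-box; the W₄₅-sheet vs LJ-sheet offset is CARRIED by `f₀`, nothing relates the two sheets),
and read `σ` off the move slack; then every ξ of the column outside the slab `‖U(ξ − ξ_ref)‖ ≤ (σ + f₀)/λ` has a radial force component `> σ` ⇒ the one-atom
move along `Δ/‖Δ‖` is unstable (`exemptNear_of_boxSlope` with the existing `τ`-control).  Labels whose cut-off status (`‖X‖ ≤ 7`) can change on the ball
are kept OUT of the finset `B` and priced by the leaf as an explicit error inside `f₀`/`σ` (the lemma is stated for an arbitrary finset `B`).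

NO definitions; 0 sorry; standard axioms; no instances / notation / `#eval`.  `--supports stmt-AtomisticToContinuum-27623`.
-/

noncomputable section

namespace Summit.AtomisticToContinuum.Crystallization.Theorems.FrustratedLawDichotomyStrainedPatchHomForceRing

open scoped BigOperators RealInnerProductSpace
open Summit.AtomisticToContinuum.Crystallization.Theorems.FrustratedLawDichotomyStrainedPatchTaylorChord (segR segN segS segG segGd segN_eq_inner)
open Summit.AtomisticToContinuum.Crystallization.Theorems.FrustratedLawDichotomyStrainedPatchHomConvexSegment
  (slope_growth_of_curvature_sum norm_shuffle_segment_le)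
open Summit.AtomisticToContinuum.Crystallization.Theorems.ChargedEnergyGapNegative (E3)
open Summit.AtomisticToContinuum.Crystallization.Theorems.FrustratedLawDichotomyStrainedPatchHomSplit (latPt hexFrame hcpShift)
open Summit.AtomisticToContinuum.Crystallization.Theorems.FrustratedLawDichotomyStrainedPatchHomLatticeBoxHcp (norm_shifted_gt)
open Summit.AtomisticToContinuum.Crystallization.Theorems.FrustratedLawDichotomyStrainedPatchHomPolar (norm_apply_ge_of_norm_sub_one_le)

/-! ## §0. The segment slope at the end points -/

/-- `segG W₁ p Δ 1 = W₁‖p + Δ‖ · ⟪p + Δ, Δ⟫ / ‖p + Δ‖` (the force component along `Δ` at the target point). [formal bookkeeping] -/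
theorem segG_one (W₁ : ℝ → ℝ) (p Δ : E3) : segG W₁ p Δ 1 = W₁ ‖p + Δ‖ * (⟪p + Δ, Δ⟫ / ‖p + Δ‖) := by
  simp only [segG, segS, segR, segN_eq_inner, one_smul]

/-- `segG W₁ p Δ 0 = W₁‖p‖ · ⟪p, Δ⟫ / ‖p‖` (the force component along `Δ` at the reference point). [formal bookkeeping] -/
theorem segG_zero (W₁ : ℝ → ℝ) (p Δ : E3) : segG W₁ p Δ 0 = W₁ ‖p‖ * (⟪p, Δ⟫ / ‖p‖) := by
  simp only [segG, segS, segR, segN_eq_inner, zero_smul, add_zero]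

/-- In the degenerate direction `Δ = 0` every segment slope vanishes. [formal bookkeeping] -/
theorem segG_of_zero (W₁ : ℝ → ℝ) (p : E3) (s : ℝ) : segG W₁ p 0 s = 0 := by
  simp [segG, segS, segN]

/-! ## §1. Generic label sums: growth, exterior bound, slab confinement -/

/-- ★ **RADIAL GROWTH OF THE SLOPE SUM** (`…HomConvexSegment.slope_growth_of_curvature_sum` at `s = 1`): with the tube / regularity hypotheses and
the curvature-sum (force-Jacobian) floor `λ‖Δ‖²` along the segment, `Σ_i segG … 0 + λ‖Δ‖² ≤ Σ_i segG … 1`. [folklore chaining] -/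
theorem sum_slope_growth_one {ι : Type*} (S : Finset ι) (p : ι → E3) {Δ : E3} (hΔ : Δ ≠ 0)
    {W₁ : ℝ → ℝ} (J : Finset ℝ) {a b lam : ℝ} (ha : 0 < a) (hcont : ContinuousOn W₁ (Set.Icc a b))
    (hdiff : ∀ r, a < r → r < b → r ∉ J → HasDerivAt W₁ (deriv W₁ r) r)
    (htube : ∀ i ∈ S, ∀ s ∈ Set.Icc (0 : ℝ) 1, a ≤ ‖p i + s • Δ‖ ∧ ‖p i + s • Δ‖ ≤ b)
    (hcurv : ∀ s ∈ Set.Ioo (0 : ℝ) 1, (∀ i ∈ S, a < segR (p i) Δ s ∧ segR (p i) Δ s < b ∧ segR (p i) Δ s ∉ J) →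
      lam * ‖Δ‖ ^ 2 ≤ ∑ i ∈ S, segGd W₁ (p i) Δ s) :
    ∑ i ∈ S, segG W₁ (p i) Δ 0 + lam * ‖Δ‖ ^ 2 ≤ ∑ i ∈ S, segG W₁ (p i) Δ 1 := by
  have h := slope_growth_of_curvature_sum S p hΔ J ha hcont hdiff htube hcurv 1 (Set.right_mem_Icc.2 zero_le_one)
  simpa using h

/-- ★ **EXTERIOR (ANNULUS) FORCE BOUND**: a reference bound `|Σ_i segG … 0| ≤ f₀‖Δ‖` turns the growth into `(λ‖Δ‖ − f₀)‖Δ‖ ≤ Σ_i segG … 1` —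
the force component along `Δ` at the target is at least `λ‖Δ‖ − f₀` per unit length. [folklore chaining] -/
theorem sum_slope_exterior {ι : Type*} (S : Finset ι) (p : ι → E3) {Δ : E3} (hΔ : Δ ≠ 0)
    {W₁ : ℝ → ℝ} (J : Finset ℝ) {a b lam f₀ : ℝ} (ha : 0 < a) (hcont : ContinuousOn W₁ (Set.Icc a b))
    (hdiff : ∀ r, a < r → r < b → r ∉ J → HasDerivAt W₁ (deriv W₁ r) r)
    (htube : ∀ i ∈ S, ∀ s ∈ Set.Icc (0 : ℝ) 1, a ≤ ‖p i + s • Δ‖ ∧ ‖p i + s • Δ‖ ≤ b)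
    (hcurv : ∀ s ∈ Set.Ioo (0 : ℝ) 1, (∀ i ∈ S, a < segR (p i) Δ s ∧ segR (p i) Δ s < b ∧ segR (p i) Δ s ∉ J) →
      lam * ‖Δ‖ ^ 2 ≤ ∑ i ∈ S, segGd W₁ (p i) Δ s)
    (hf₀ : |∑ i ∈ S, segG W₁ (p i) Δ 0| ≤ f₀ * ‖Δ‖) :
    (lam * ‖Δ‖ - f₀) * ‖Δ‖ ≤ ∑ i ∈ S, segG W₁ (p i) Δ 1 := by
  have h := sum_slope_growth_one S p hΔ J ha hcont hdiff htube hcurv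
  have h0 := (abs_le.1 hf₀).1
  nlinarith

/-- ★★ **SLAB CONFINEMENT `T″`**: if moreover the force component along `Δ` at the TARGET is capped, `Σ_i segG … 1 ≤ σ‖Δ‖` (e.g. the site is not
exempt), then `λ‖Δ‖ ≤ σ + f₀`: the capped targets lie in the slab `‖Δ‖ ≤ (σ + f₀)/λ` about the reference. [folklore chaining] -/
theorem slab_confinement {ι : Type*} (S : Finset ι) (p : ι → E3) {Δ : E3} (hΔ : Δ ≠ 0)
    {W₁ : ℝ → ℝ} (J : Finset ℝ) {a b lam f₀ σ : ℝ} (ha : 0 < a) (hcont : ContinuousOn W₁ (Set.Icc a b))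
    (hdiff : ∀ r, a < r → r < b → r ∉ J → HasDerivAt W₁ (deriv W₁ r) r)
    (htube : ∀ i ∈ S, ∀ s ∈ Set.Icc (0 : ℝ) 1, a ≤ ‖p i + s • Δ‖ ∧ ‖p i + s • Δ‖ ≤ b)
    (hcurv : ∀ s ∈ Set.Ioo (0 : ℝ) 1, (∀ i ∈ S, a < segR (p i) Δ s ∧ segR (p i) Δ s < b ∧ segR (p i) Δ s ∉ J) →
      lam * ‖Δ‖ ^ 2 ≤ ∑ i ∈ S, segGd W₁ (p i) Δ s)
    (hf₀ : |∑ i ∈ S, segG W₁ (p i) Δ 0| ≤ f₀ * ‖Δ‖) (hσ : ∑ i ∈ S, segG W₁ (p i) Δ 1 ≤ σ * ‖Δ‖) :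
    lam * ‖Δ‖ ≤ σ + f₀ := by
  have h := sum_slope_exterior S p hΔ J ha hcont hdiff htube hcurv hf₀
  have hpos : 0 < ‖Δ‖ := norm_pos_iff.2 hΔ
  nlinarith

/-! ## §2. The hcp shifted family (any force profile regular on `r ≥ 3/8`) -/

/-- ★★ **RADIAL GROWTH OF THE hcp `B`-FAMILY FORCE.**  For `‖U − 1‖ ≤ 1/4`, `‖ξ₀‖, ‖ξ‖ ≤ 1/4`, any label finset `B`, a force profile `W₁` continuous
on `[3/8, ∞)` and differentiable on `(3/8, ∞)`, and the force-JACOBIAN floor `λ‖Δ‖² ≤ Σ_b segGd W₁ p_b Δ s` along the segment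
(`p_b = latPt U hexFrame b + U(hcpShift + ξ₀)`, `Δ = U(ξ − ξ₀)`): `Σ_b segG W₁ p_b Δ 0 + λ‖Δ‖² ≤ Σ_b segG W₁ p_b Δ 1`. [folklore chaining] -/
theorem hcpForce_growth (B : Finset (Fin 3 → ℤ)) {U : E3 →L[ℝ] E3} (hU : ‖U - 1‖ ≤ 1 / 4) {ξ₀ ξ : E3} (hξ₀ : ‖ξ₀‖ ≤ 1 / 4) (hξ : ‖ξ‖ ≤ 1 / 4)
    {W₁ : ℝ → ℝ} (hcont : ContinuousOn W₁ (Set.Ici (3 / 8))) (hdiff : ∀ r, (3 : ℝ) / 8 < r → HasDerivAt W₁ (deriv W₁ r) r) {lam : ℝ}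
    (hcurv : ∀ s ∈ Set.Ioo (0 : ℝ) 1,
      lam * ‖U (ξ - ξ₀)‖ ^ 2 ≤ ∑ bb ∈ B, segGd W₁ (latPt U hexFrame bb + U (hcpShift + ξ₀)) (U (ξ - ξ₀)) s) :
    ∑ bb ∈ B, segG W₁ (latPt U hexFrame bb + U (hcpShift + ξ₀)) (U (ξ - ξ₀)) 0 + lam * ‖U (ξ - ξ₀)‖ ^ 2 ≤
      ∑ bb ∈ B, segG W₁ (latPt U hexFrame bb + U (hcpShift + ξ₀)) (U (ξ - ξ₀)) 1 := by
  by_cases hΔ : U (ξ - ξ₀) = 0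
  · -- degenerate direction: both slope sums vanish; `λ·0 ≤ 0`
    simp [hΔ, segG_of_zero]
  set p : (Fin 3 → ℤ) → E3 := fun bb => latPt U hexFrame bb + U (hcpShift + ξ₀) with hp
  set Δ : E3 := U (ξ - ξ₀) with hΔdef
  set bhi : ℝ := (∑ bb ∈ B, ‖p bb‖) + ‖Δ‖ + 1 with hbhi
  have hseg : ∀ bb : Fin 3 → ℤ, ∀ s : ℝ, p bb + s • Δ = latPt U hexFrame bb + U (hcpShift + (ξ₀ + s • (ξ - ξ₀))) := by
    intro bb s
    simp only [hp, hΔdef, map_add, map_smul]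
    abel
  have htube : ∀ bb ∈ B, ∀ s ∈ Set.Icc (0 : ℝ) 1, 3 / 8 ≤ ‖p bb + s • Δ‖ ∧ ‖p bb + s • Δ‖ ≤ bhi := by
    intro bb hbb s hs
    constructor
    · rw [hseg]
      exact (norm_shifted_gt hU (norm_shuffle_segment_le hξ₀ hξ hs) bb).le
    · have h1 : ‖p bb + s • Δ‖ ≤ ‖p bb‖ + ‖Δ‖ := by
        calc ‖p bb + s • Δ‖ ≤ ‖p bb‖ + ‖s • Δ‖ := norm_add_le _ _
          _ ≤ ‖p bb‖ + ‖Δ‖ := by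
              rw [norm_smul, Real.norm_eq_abs, abs_of_nonneg hs.1]
              nlinarith [norm_nonneg Δ, hs.2]
      have h2 : ‖p bb‖ ≤ ∑ bb ∈ B, ‖p bb‖ := Finset.single_le_sum (fun _ _ => norm_nonneg _) hbb
      rw [hbhi]; linarith
  have ha : (0 : ℝ) < 3 / 8 := by norm_num
  have hcont' : ContinuousOn W₁ (Set.Icc (3 / 8) bhi) := hcont.mono fun r hr => hr.1
  have hdiff' : ∀ r, (3 : ℝ) / 8 < r → r < bhi → r ∉ (∅ : Finset ℝ) → HasDerivAt W₁ (deriv W₁ r) r := fun r hr _ _ => hdiff r hr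
  have hcurv' : ∀ s ∈ Set.Ioo (0 : ℝ) 1, (∀ bb ∈ B, 3 / 8 < segR (p bb) Δ s ∧ segR (p bb) Δ s < bhi ∧ segR (p bb) Δ s ∉ (∅ : Finset ℝ)) →
      lam * ‖Δ‖ ^ 2 ≤ ∑ bb ∈ B, segGd W₁ (p bb) Δ s := fun s hs _ => hcurv s hs
  exact sum_slope_growth_one B p hΔ ∅ ha hcont' hdiff' htube hcurv'

/-- ★★ **EXTERIOR FORCE BOUND FOR THE hcp `B`-FAMILY**: with a reference bound `|Σ_b segG … 0| ≤ f₀‖Δ‖`,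
`(λ‖Δ‖ − f₀)‖Δ‖ ≤ Σ_b segG W₁ p_b Δ 1`. [folklore chaining] -/
theorem hcpForce_exterior (B : Finset (Fin 3 → ℤ)) {U : E3 →L[ℝ] E3} (hU : ‖U - 1‖ ≤ 1 / 4) {ξ₀ ξ : E3} (hξ₀ : ‖ξ₀‖ ≤ 1 / 4) (hξ : ‖ξ‖ ≤ 1 / 4)
    {W₁ : ℝ → ℝ} (hcont : ContinuousOn W₁ (Set.Ici (3 / 8))) (hdiff : ∀ r, (3 : ℝ) / 8 < r → HasDerivAt W₁ (deriv W₁ r) r) {lam f₀ : ℝ}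
    (hcurv : ∀ s ∈ Set.Ioo (0 : ℝ) 1,
      lam * ‖U (ξ - ξ₀)‖ ^ 2 ≤ ∑ bb ∈ B, segGd W₁ (latPt U hexFrame bb + U (hcpShift + ξ₀)) (U (ξ - ξ₀)) s)
    (hf₀ : |∑ bb ∈ B, segG W₁ (latPt U hexFrame bb + U (hcpShift + ξ₀)) (U (ξ - ξ₀)) 0| ≤ f₀ * ‖U (ξ - ξ₀)‖) :
    (lam * ‖U (ξ - ξ₀)‖ - f₀) * ‖U (ξ - ξ₀)‖ ≤ ∑ bb ∈ B, segG W₁ (latPt U hexFrame bb + U (hcpShift + ξ₀)) (U (ξ - ξ₀)) 1 := by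
  have h := hcpForce_growth B hU hξ₀ hξ hcont hdiff hcurv
  have h0 := (abs_le.1 hf₀).1
  nlinarith

/-- ★★★ **SLAB CONFINEMENT `T″` FOR THE hcp `B`-FAMILY**: if the target's force component along `Δ = U(ξ − ξ₀)` is capped by `σ‖Δ‖` and `ξ ≠ ξ₀`
(more precisely `U(ξ − ξ₀) ≠ 0`), then `λ‖U(ξ − ξ₀)‖ ≤ σ + f₀`; with `‖U − 1‖ ≤ 1/4` also `λ·(3/4)‖ξ − ξ₀‖ ≤ σ + f₀` when `0 ≤ λ`. [folklore chaining] -/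
theorem hcpForce_slab_confinement (B : Finset (Fin 3 → ℤ)) {U : E3 →L[ℝ] E3} (hU : ‖U - 1‖ ≤ 1 / 4) {ξ₀ ξ : E3} (hξ₀ : ‖ξ₀‖ ≤ 1 / 4)
    (hξ : ‖ξ‖ ≤ 1 / 4) (hΔ : U (ξ - ξ₀) ≠ 0)
    {W₁ : ℝ → ℝ} (hcont : ContinuousOn W₁ (Set.Ici (3 / 8))) (hdiff : ∀ r, (3 : ℝ) / 8 < r → HasDerivAt W₁ (deriv W₁ r) r) {lam f₀ σ : ℝ}
    (hcurv : ∀ s ∈ Set.Ioo (0 : ℝ) 1,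
      lam * ‖U (ξ - ξ₀)‖ ^ 2 ≤ ∑ bb ∈ B, segGd W₁ (latPt U hexFrame bb + U (hcpShift + ξ₀)) (U (ξ - ξ₀)) s)
    (hf₀ : |∑ bb ∈ B, segG W₁ (latPt U hexFrame bb + U (hcpShift + ξ₀)) (U (ξ - ξ₀)) 0| ≤ f₀ * ‖U (ξ - ξ₀)‖)
    (hσ : ∑ bb ∈ B, segG W₁ (latPt U hexFrame bb + U (hcpShift + ξ₀)) (U (ξ - ξ₀)) 1 ≤ σ * ‖U (ξ - ξ₀)‖) :
    lam * ‖U (ξ - ξ₀)‖ ≤ σ + f₀ ∧ (0 ≤ lam → lam * (3 / 4 * ‖ξ - ξ₀‖) ≤ σ + f₀) := by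
  have h := hcpForce_exterior B hU hξ₀ hξ hcont hdiff hcurv hf₀
  have hpos : 0 < ‖U (ξ - ξ₀)‖ := norm_pos_iff.2 hΔ
  have h1 : lam * ‖U (ξ - ξ₀)‖ ≤ σ + f₀ := by nlinarith
  refine ⟨h1, fun hlam => ?_⟩
  have h34 := norm_apply_ge_of_norm_sub_one_le hU (ξ - ξ₀)
  calc lam * (3 / 4 * ‖ξ - ξ₀‖) ≤ lam * ‖U (ξ - ξ₀)‖ := by
        apply mul_le_mul_of_nonneg_left _ hlam; linarith
    _ ≤ σ + f₀ := h1

/-! ## §3. The Lennard-Jones force profile `r ↦ r⁻⁷ − r⁻¹³` -/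

/-- Regularity of the Lennard-Jones force profile: derivative everywhere on `r ≠ 0`. [formal bookkeeping] -/
theorem hasDerivAt_ljProfile {r : ℝ} (hr : r ≠ 0) :
    HasDerivAt (fun x : ℝ => x⁻¹ ^ 7 - x⁻¹ ^ 13) (deriv (fun x : ℝ => x⁻¹ ^ 7 - x⁻¹ ^ 13) r) r := by
  have h : HasDerivAt (fun x : ℝ => x⁻¹ ^ 7 - x⁻¹ ^ 13)
      ((7 : ℕ) * r⁻¹ ^ (7 - 1) * (-(r ^ 2)⁻¹) - (13 : ℕ) * r⁻¹ ^ (13 - 1) * (-(r ^ 2)⁻¹)) r :=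
    ((hasDerivAt_inv hr).pow 7).sub ((hasDerivAt_inv hr).pow 13)
  exact h.differentiableAt.hasDerivAt

/-- Continuity of the Lennard-Jones force profile on `[3/8, ∞)`. [formal bookkeeping] -/
theorem continuousOn_ljProfile : ContinuousOn (fun x : ℝ => x⁻¹ ^ 7 - x⁻¹ ^ 13) (Set.Ici (3 / 8)) := by
  intro r hr
  have hr0 : r ≠ 0 := by
    have : (3 : ℝ) / 8 ≤ r := hr
    exact (lt_of_lt_of_le (by norm_num) this).ne'
  exact (hasDerivAt_ljProfile hr0).continuousAt.continuousWithinAt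

/-- The kernel algebra: `W₁(r)·(x / r) = (r⁻⁸ − r⁻¹⁴)·x` (also at `r = 0` by the junk value of `⁻¹`) — the segment slope `segG W₁ p Δ s` IS the exempt prune's slope kernel
`(‖X‖⁻⁸ − ‖X‖⁻¹⁴)⟪X, Δ⟫` at `X = p + sΔ`. [arithmetic] -/
theorem ljProfile_mul_div (r x : ℝ) : (r⁻¹ ^ 7 - r⁻¹ ^ 13) * (x / r) = (r⁻¹ ^ 8 - r⁻¹ ^ 14) * x := by
  rw [div_eq_mul_inv]
  ring

/-- The segment slope of the LJ profile in kernel form at the target point. [formal bookkeeping] -/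
theorem segG_ljProfile_one (p Δ : E3) :
    segG (fun x : ℝ => x⁻¹ ^ 7 - x⁻¹ ^ 13) p Δ 1 = (‖p + Δ‖⁻¹ ^ 8 - ‖p + Δ‖⁻¹ ^ 14) * ⟪p + Δ, Δ⟫ := by
  rw [segG_one, ljProfile_mul_div]

/-- The segment slope of the LJ profile in kernel form at the reference point. [formal bookkeeping] -/
theorem segG_ljProfile_zero (p Δ : E3) :
    segG (fun x : ℝ => x⁻¹ ^ 7 - x⁻¹ ^ 13) p Δ 0 = (‖p‖⁻¹ ^ 8 - ‖p‖⁻¹ ^ 14) * ⟪p, Δ⟫ := by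
  rw [segG_zero, ljProfile_mul_div]

/-- ★★★ **EXTERIOR FORCE BOUND, LENNARD-JONES `B`-FAMILY, KERNEL FORM.**  For `‖U − 1‖ ≤ 1/4`, `‖ξ₀‖, ‖ξ‖ ≤ 1/4`, any label finset `B`, the
force-Jacobian floor `λ` of the LJ profile along `Δ = U(ξ − ξ₀)` and a reference bound `f₀`:
`(λ‖Δ‖ − f₀)‖Δ‖ ≤ Σ_b (‖X_b‖⁻⁸ − ‖X_b‖⁻¹⁴)⟪X_b, Δ⟫`, `X_b = latPt U hexFrame b + U(hcpShift + ξ)` — the τ = 0 value of the one-atom move slope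
along `−Δ/‖Δ‖` is `≤ −(λ‖Δ‖ − f₀)` (times the family-`A` and rim terms the leaf prices). [folklore chaining] -/
theorem hcpForceLJ_exterior (B : Finset (Fin 3 → ℤ)) {U : E3 →L[ℝ] E3} (hU : ‖U - 1‖ ≤ 1 / 4) {ξ₀ ξ : E3} (hξ₀ : ‖ξ₀‖ ≤ 1 / 4)
    (hξ : ‖ξ‖ ≤ 1 / 4) {lam f₀ : ℝ}
    (hcurv : ∀ s ∈ Set.Ioo (0 : ℝ) 1, lam * ‖U (ξ - ξ₀)‖ ^ 2 ≤
      ∑ bb ∈ B, segGd (fun x : ℝ => x⁻¹ ^ 7 - x⁻¹ ^ 13) (latPt U hexFrame bb + U (hcpShift + ξ₀)) (U (ξ - ξ₀)) s)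
    (hf₀ : |∑ bb ∈ B, (‖latPt U hexFrame bb + U (hcpShift + ξ₀)‖⁻¹ ^ 8 - ‖latPt U hexFrame bb + U (hcpShift + ξ₀)‖⁻¹ ^ 14) *
        ⟪latPt U hexFrame bb + U (hcpShift + ξ₀), U (ξ - ξ₀)⟫| ≤ f₀ * ‖U (ξ - ξ₀)‖) :
    (lam * ‖U (ξ - ξ₀)‖ - f₀) * ‖U (ξ - ξ₀)‖ ≤
      ∑ bb ∈ B, (‖latPt U hexFrame bb + U (hcpShift + ξ)‖⁻¹ ^ 8 - ‖latPt U hexFrame bb + U (hcpShift + ξ)‖⁻¹ ^ 14) *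
        ⟪latPt U hexFrame bb + U (hcpShift + ξ), U (ξ - ξ₀)⟫ := by
  have hpt : ∀ bb : Fin 3 → ℤ, latPt U hexFrame bb + U (hcpShift + ξ₀) + U (ξ - ξ₀) = latPt U hexFrame bb + U (hcpShift + ξ) := by
    intro bb
    rw [add_assoc, ← map_add]
    congr 2
    abel
  have e0 : ∑ bb ∈ B, segG (fun x : ℝ => x⁻¹ ^ 7 - x⁻¹ ^ 13) (latPt U hexFrame bb + U (hcpShift + ξ₀)) (U (ξ - ξ₀)) 0 =
      ∑ bb ∈ B, (‖latPt U hexFrame bb + U (hcpShift + ξ₀)‖⁻¹ ^ 8 - ‖latPt U hexFrame bb + U (hcpShift + ξ₀)‖⁻¹ ^ 14) *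
        ⟪latPt U hexFrame bb + U (hcpShift + ξ₀), U (ξ - ξ₀)⟫ :=
    Finset.sum_congr rfl fun bb _ => segG_ljProfile_zero _ _
  have e1 : ∑ bb ∈ B, segG (fun x : ℝ => x⁻¹ ^ 7 - x⁻¹ ^ 13) (latPt U hexFrame bb + U (hcpShift + ξ₀)) (U (ξ - ξ₀)) 1 =
      ∑ bb ∈ B, (‖latPt U hexFrame bb + U (hcpShift + ξ)‖⁻¹ ^ 8 - ‖latPt U hexFrame bb + U (hcpShift + ξ)‖⁻¹ ^ 14) *
        ⟪latPt U hexFrame bb + U (hcpShift + ξ), U (ξ - ξ₀)⟫ := by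
    refine Finset.sum_congr rfl fun bb _ => ?_
    rw [segG_ljProfile_one, hpt]
  have hf₀' : |∑ bb ∈ B, segG (fun x : ℝ => x⁻¹ ^ 7 - x⁻¹ ^ 13) (latPt U hexFrame bb + U (hcpShift + ξ₀)) (U (ξ - ξ₀)) 0| ≤
      f₀ * ‖U (ξ - ξ₀)‖ := by rw [e0]; exact hf₀
  have h := hcpForce_exterior B hU hξ₀ hξ continuousOn_ljProfile (fun r hr => hasDerivAt_ljProfile (lt_trans (by norm_num) hr).ne') hcurv hf₀'
  rw [e1] at h
  exact h

/-- ★★★ **SLAB CONFINEMENT `T″`, LENNARD-JONES `B`-FAMILY, KERNEL FORM**: if the target's LJ force component along `Δ = U(ξ − ξ₀) ≠ 0` is capped,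
`Σ_b (‖X_b‖⁻⁸ − ‖X_b‖⁻¹⁴)⟪X_b, Δ⟫ ≤ σ‖Δ‖`, then `λ‖Δ‖ ≤ σ + f₀`, and (for `λ ≥ 0`) `λ·(3/4)‖ξ − ξ₀‖ ≤ σ + f₀`: the capped (non-exempt) shuffles of the
column lie in the slab of half-thickness `(σ + f₀)/λ` about the reference (in `U`-metric; `4(σ + f₀)/(3λ)` in `ξ`). [folklore chaining] -/
theorem hcpForceLJ_slab_confinement (B : Finset (Fin 3 → ℤ)) {U : E3 →L[ℝ] E3} (hU : ‖U - 1‖ ≤ 1 / 4) {ξ₀ ξ : E3} (hξ₀ : ‖ξ₀‖ ≤ 1 / 4)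
    (hξ : ‖ξ‖ ≤ 1 / 4) (hΔ : U (ξ - ξ₀) ≠ 0) {lam f₀ σ : ℝ}
    (hcurv : ∀ s ∈ Set.Ioo (0 : ℝ) 1, lam * ‖U (ξ - ξ₀)‖ ^ 2 ≤
      ∑ bb ∈ B, segGd (fun x : ℝ => x⁻¹ ^ 7 - x⁻¹ ^ 13) (latPt U hexFrame bb + U (hcpShift + ξ₀)) (U (ξ - ξ₀)) s)
    (hf₀ : |∑ bb ∈ B, (‖latPt U hexFrame bb + U (hcpShift + ξ₀)‖⁻¹ ^ 8 - ‖latPt U hexFrame bb + U (hcpShift + ξ₀)‖⁻¹ ^ 14) *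
        ⟪latPt U hexFrame bb + U (hcpShift + ξ₀), U (ξ - ξ₀)⟫| ≤ f₀ * ‖U (ξ - ξ₀)‖)
    (hσ : ∑ bb ∈ B, (‖latPt U hexFrame bb + U (hcpShift + ξ)‖⁻¹ ^ 8 - ‖latPt U hexFrame bb + U (hcpShift + ξ)‖⁻¹ ^ 14) *
        ⟪latPt U hexFrame bb + U (hcpShift + ξ), U (ξ - ξ₀)⟫ ≤ σ * ‖U (ξ - ξ₀)‖) :
    lam * ‖U (ξ - ξ₀)‖ ≤ σ + f₀ ∧ (0 ≤ lam → lam * (3 / 4 * ‖ξ - ξ₀‖) ≤ σ + f₀) := by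
  have h := hcpForceLJ_exterior B hU hξ₀ hξ hcurv hf₀
  have hpos : 0 < ‖U (ξ - ξ₀)‖ := norm_pos_iff.2 hΔ
  have h1 : lam * ‖U (ξ - ξ₀)‖ ≤ σ + f₀ := by nlinarith
  refine ⟨h1, fun hlam => ?_⟩
  have h34 := norm_apply_ge_of_norm_sub_one_le hU (ξ - ξ₀)
  calc lam * (3 / 4 * ‖ξ - ξ₀‖) ≤ lam * ‖U (ξ - ξ₀)‖ := by
        apply mul_le_mul_of_nonneg_left _ hlam; linarith
    _ ≤ σ + f₀ := h1

end Summit.AtomisticToContinuum.Crystallization.Theorems.FrustratedLawDichotomyStrainedPatchHomForceRing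

end
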